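import Summits.QuantumFields.YangMills.Theorems.BalabanUVNodesN15KingModelPotentialLogDet

/-!
# N15 (NE2) King-model rung, PART 43 — THE CONTINUUM LIMIT OF THE FREE-ENERGY RESPONSE: `e_k(z) → e_∞(z) := |Λ|⁻¹·tr(C^{(∞)}_z·∂_zΔ^{(∞)}_{z·v})`
# at every complex coupling of the disc, and `e_∞` is HOLOMORPHIC there (Vitali), with 41's volume-uniform bound

Eleventh generation (g11) of the seat `pub-ymgap-dag-n15-d`, part 43 (on 41 `…PotentialLogDet`, 28d `…PotentialComplexLimit`, 28c `…VitaliDisc`).  Part 41 made the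
response `e_k(z) = |Λ|⁻¹·Σ_{x,y} C^{(k)}_z(x,y)·∂_zΔ^{(k)}_{z·v}(y,x)` of the Gaussian free energy per site a holomorphic function of the coupling, bounded uniformly in the
cutoff and in the volume.  Part 28d constructed the holomorphic continuum limits `C^{(∞)}_z`, `Δ^{(∞)}_{z·v}` (entrywise Vitali limits, with `C^{(k+1)}_z → C^{(∞)}_z`,
`Δ^{(k+1)} → Δ^{(∞)}` on the ball `‖z‖ < r_K∕w₀`); 28c's `vitali_disc_deriv` adds `∂_zΔ^{(k+1)}_{z·v}(y,x) → ∂_zΔ^{(∞)}_{z·v}(y,x)`.  Finite sums of products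
converge, so on King-admissible tori, in 10e's window intersected with `w₀ ≤ w̄`:

* §1 `tendsto_deriv_kingLevelPotC` — the coupling-derivatives of the levels converge to the derivative of the limit level (28c `vitali_disc_deriv` on 28d's data);
* §2 ★★★ `tendsto_logDetResponseC` — for every `z` of the ball `‖z‖ < r_K∕w₀`: `e_{k+1}(z) → e_∞(z) := |Λ|⁻¹·Σ_{x,y} C^{(∞)}_z(x,y)·∂_zΔ^{(∞)}_{z·v}(y,x)` (written out; no
  new definition) — the response of the CONTINUUM-LIMIT Gaussian free energy per site;
* §3 ★★ `logDetResponse_limit_holomorphic` — on every ball `‖z‖ < R₂ − ρ₀` (`R₂ = (r∕(1+r))·min(r_K∕w₀,1)`, `0 < ρ₀ < R₂`): the limit is HOLOMORPHIC, is the locally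
  uniform limit of the `e_{k+1}`, and obeys 41's volume-uniform bound `‖e_∞(z)‖ ≤ (2∕γ₀)·(M_Δ∕ρ₀)·K_{d+1}((1−λ)2κ′)` (28c `vitali_disc` on 41's holomorphy and bound).

References (method): Vitali on a disc (28c) [folklore]; Jacobi's formula (tree `LogDetDerivative`); two-constants via 32 (BY NAME); template [B9] Thm 3.4 p.400;
King (4.32)–(4.34) p.674, §4 pp.675–676 (the `k → ∞` limit, A = 0).

HONEST SCOPE.  King's A = 0 SCALAR model, King-admissible tori (odd `L ≥ 3`, `a, m² > 0`); the Gaussian log-determinant response per site (not the interacting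
vacuum energy, not Bałaban's `E`, not King's `Z_k`); `e_∞` is identified with the trace formula over the 28d limit objects — that `e_∞` is the derivative of
a limit free-energy DENSITY is NOT asserted here (the densities `f_k` themselves are not shown to converge in this file); NOT a node discharge; count-neutral.
-/

noncomputable section

open scoped BigOperators Matrix
open Filter Topology Metric Finset Complex

namespace Summit.QuantumFields.YangMills.BalabanUVNodes.N15.KingModel

open Literature.MathematicalPhysics.QuantumFieldTheory.Balaban1983to89 hiding blockOf
open Literature.MathematicalPhysics.QuantumFieldTheory.Balaban1983to89.B4Sect5Proof (latticeConst latticeConst_nonneg)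
open Literature.MathematicalPhysics.QuantumFieldTheory.Balaban1983to89.B5Prop11Plancherel (Tor fine)
open Literature.MathematicalPhysics.QuantumFieldTheory.Balaban1983to89.B13RealSliceEntryLetters (lam lam_nonneg lam_lt_one)
open Literature.MathematicalPhysics.QuantumFieldTheory.King1986 (aK aK_pos aK_le)
open Literature.MathematicalPhysics.QuantumFieldTheory.King1986.Torus (gam0L gam0L_pos tdistT tdistT_isPseudoDist kapCT kapCT_pos_le)
open Summit.QuantumFields.YangMills.BalabanUVNodes.N15KingModelRung.Curved (underPtN)

variable {d : ℕ}

section KingU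

variable (L : ℕ) [NeZero L]

/-! ## §1 The derivatives of the levels converge -/

/-- **THE COUPLING-DERIVATIVES OF THE LEVELS CONVERGE TO THE DERIVATIVE OF THE LIMIT LEVEL.**  For odd `L ≥ 3`, `a, m² > 0` there is `w₁ > 0` such that for every
volume exponent, every potential tower of 10e's window (`sup|v_N| ≤ w₀ ≤ w₁`, `w₀ > 0`, coherence defect `≤ ν₀s^k`), all unit sites and every `z` of the ball
`‖z‖ < r_K∕w₀`:  `∂_ζ Δ^{(k+1)}_{ζ·v}(b,b′)|_z → ∂_ζ Δ^{(∞)}_{ζ·v}(b,b′)|_z` as `k → ∞` (28c's `vitali_disc_deriv`: the levels are holomorphic and bounded by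
`a + 2a²∕m²` on the ball (28b∕28d) and converge there (28d `king_continuumLimit_operator_holomorphic` (i)); `Δ^{(∞)}` IS their Vitali limit by definition).
[cite: King1986, §4 pp.675–676 (A = 0 template); Balaban1985BackgroundPropagators, Thm 3.4 p.400] -/
theorem tendsto_deriv_kingLevelPotC (hLodd : Odd L) (hL : 2 ≤ L) {a m2 : ℝ} (ha : 0 < a) (hm : 0 < m2) :
    ∃ w₁ : ℝ, 0 < w₁ ∧
      ∀ (e : ℕ) (v : ∀ N : ℕ, Tor (fine N (kingU d L e)) → ℝ) (w₀ ν₀ s : ℝ),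
      0 ≤ ν₀ → ν₀ ≤ w₁ → 0 ≤ s → s ≤ (L : ℝ) ^ (-(1 / 2 : ℝ)) →
      0 < w₀ → (∀ (N : ℕ) (x : Tor (fine N (kingU d L e))), |v N x| ≤ w₀) → w₀ ≤ w₁ →
      (∀ (k : ℕ), 1 ≤ k → ∀ x' : Tor (fine (L ^ 1 * L ^ k) (kingU d L e)),
          |v (L ^ 1 * L ^ k) x' - v (L ^ k) (underPtN L k 1 (kingU d L e) x')| ≤ ν₀ * s ^ k) →
      ∀ (b b' : Tor (kingU d L e)), ∀ z ∈ ball (0 : ℂ) (cplxWindow d a m2 L / w₀),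
        Tendsto (fun k => deriv (fun ζ : ℂ => kingLevelPotC d a m2 L (kingM d L e) (k + 1) ζ (v (L ^ (k + 1))) b b') z) atTop
          (𝓝 (deriv (fun ζ : ℂ => kingLevelLimC a m2 L (kingM d L e) v ζ b b') z)) := by
  obtain ⟨w₁, hw₁, H⟩ := king_continuumLimit_operator_holomorphic (d := d) L hLodd hL ha hm
  refine ⟨w₁, hw₁, ?_⟩
  intro e v w₀ ν₀ s hν₀ hν₁ hs0 hs1 hw₀ hv hw₁' hcoh b b' z hz
  have hwin := cplxWindow_pos (d := d) (a := a) (m2 := m2) (L := L) ha hm hL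
  set R : ℝ := cplxWindow d a m2 L / w₀ with hR
  have hRpos : 0 < R := div_pos hwin hw₀
  have hzw : ∀ ζ ∈ ball (0 : ℂ) R, ‖ζ‖ * w₀ ≤ cplxWindow d a m2 L := by
    intro ζ hζ
    rw [mem_ball_zero_iff] at hζ
    have : ‖ζ‖ * w₀ < cplxWindow d a m2 L / w₀ * w₀ := mul_lt_mul_of_pos_right hζ hw₀
    rw [div_mul_cancel₀ _ hw₀.ne'] at this
    exact this.le
  set g : ℕ → ℂ → ℂ := fun k ζ => kingLevelPotC d a m2 L (kingM d L e) (k + 1) ζ (v (L ^ (k + 1))) b b' with hg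
  have hLr : (1 : ℝ) < L := by exact_mod_cast (by omega : 1 < L)
  have hd : ∀ k, DifferentiableOn ℂ (g k) (ball 0 R) := by
    intro k ζ hζ
    have haK := aK_pos ha hLr (Nat.succ_le_succ (Nat.zero_le k))
    have hζm : ‖ζ‖ * w₀ < m2 := lt_of_le_of_lt ((hzw ζ hζ).trans (min_le_left _ _)) (by linarith)
    exact (differentiableAt_effLaplacianPotC_apply haK.le (by positivity) (hv _) hζm b b').differentiableWithinAt
  have hb : ∀ k, ∀ ζ ∈ ball (0 : ℂ) R, ‖g k ζ‖ ≤ a + 2 * a ^ 2 / m2 := fun k ζ hζ =>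
    norm_kingLevelPotC_apply_le (M := kingM d L e) ha hm hL (Nat.succ_le_succ (Nat.zero_le k)) (hv _) (hzw ζ hζ) b b'
  have hconv : ∀ t : ℝ, 0 < t → t < R → ∃ l : ℂ, Tendsto (fun k => g k (t : ℂ)) atTop (𝓝 l) := by
    intro t ht0 htR
    have ht : ((t : ℂ)) ∈ ball (0 : ℂ) R := by
      rw [mem_ball_zero_iff, Complex.norm_real, Real.norm_eq_abs, abs_of_pos ht0]; exact htR
    obtain ⟨hlev, -, -, -, -, -⟩ := H e v w₀ ν₀ s hν₀ hν₁ hs0 hs1 hw₀ hv hw₁' hcoh (t : ℂ) ht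
    exact ⟨_, (hlev b b').2⟩
  have hV := (vitali_disc_deriv hRpos hRpos hd hb hconv).2 z hz
  have hlim : (fun ζ : ℂ => kingLevelLimC a m2 L (kingM d L e) v ζ b b') = vitaliLim g := by
    funext ζ; rfl
  rw [hlim]
  exact hV

/-! ## §2 The response converges to the response of the limit objects -/

/-- ★★★ **THE CONTINUUM LIMIT OF THE FREE-ENERGY RESPONSE.**  For odd `L ≥ 3`, `a, m² > 0` there is `w₁ > 0` such that for every volume exponent, every potential
tower of the window (`sup|v_N| ≤ w₀ ≤ w₁`, `w₀ > 0`, coherence defect `≤ ν₀s^k`) and every `z` of the ball `‖z‖ < r_K∕w₀`: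
`e_{k+1}(z) → e_∞(z) := |Λ|⁻¹·Σ_{x,y} C^{(∞)}_z(x,y)·∂_ζΔ^{(∞)}_{ζ·v}(y,x)|_{ζ=z}` as `k → ∞` — the responses of the Gaussian free energies per site converge, at
every complex coupling of the disc, to the trace formula over 28d's holomorphic limit covariance and limit level (entrywise convergence 28d + §1, finite sums).
[cite: King1986, §4 pp.675–676, (4.32)–(4.34) p.674 (A = 0 template); Balaban1985BackgroundPropagators, Thm 3.4 p.400] -/
theorem tendsto_logDetResponseC (hLodd : Odd L) (hL : 2 ≤ L) {a m2 : ℝ} (ha : 0 < a) (hm : 0 < m2) :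
    ∃ w₁ : ℝ, 0 < w₁ ∧
      ∀ (e : ℕ) (v : ∀ N : ℕ, Tor (fine N (kingU d L e)) → ℝ) (w₀ ν₀ s : ℝ),
      0 ≤ ν₀ → ν₀ ≤ w₁ → 0 ≤ s → s ≤ (L : ℝ) ^ (-(1 / 2 : ℝ)) →
      0 < w₀ → (∀ (N : ℕ) (x : Tor (fine N (kingU d L e))), |v N x| ≤ w₀) → w₀ ≤ w₁ →
      (∀ (k : ℕ), 1 ≤ k → ∀ x' : Tor (fine (L ^ 1 * L ^ k) (kingU d L e)),
          |v (L ^ 1 * L ^ k) x' - v (L ^ k) (underPtN L k 1 (kingU d L e) x')| ≤ ν₀ * s ^ k) →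
      ∀ z ∈ ball (0 : ℂ) (cplxWindow d a m2 L / w₀),
        Tendsto (fun k => logDetResponseC d a m2 L (kingM d L e) (k + 1) (v (L ^ (k + 1))) z) atTop
          (𝓝 (((Fintype.card (Tor (kingU d L e)) : ℂ))⁻¹ *
            ∑ x, ∑ y, kingCovLimC a m2 L (kingM d L e) v z x y * deriv (fun ζ : ℂ => kingLevelLimC a m2 L (kingM d L e) v ζ y x) z)) := by
  obtain ⟨w₁, hw₁, H⟩ := king_continuumLimit_operator_holomorphic (d := d) L hLodd hL ha hm
  obtain ⟨w₂, hw₂, HD⟩ := tendsto_deriv_kingLevelPotC (d := d) L hLodd hL ha hm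
  refine ⟨min w₁ w₂, lt_min hw₁ hw₂, ?_⟩
  intro e v w₀ ν₀ s hν₀ hν₁ hs0 hs1 hw₀ hv hw₁' hcoh z hz
  have hν1 : ν₀ ≤ w₁ := hν₁.trans (min_le_left _ _)
  have hν2 : ν₀ ≤ w₂ := hν₁.trans (min_le_right _ _)
  have hwa : w₀ ≤ w₁ := hw₁'.trans (min_le_left _ _)
  have hwb : w₀ ≤ w₂ := hw₁'.trans (min_le_right _ _)
  obtain ⟨-, hcov, -, -, -, -⟩ := H e v w₀ ν₀ s hν₀ hν1 hs0 hs1 hw₀ hv hwa hcoh z hz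
  unfold logDetResponseC
  refine Tendsto.const_mul _ (tendsto_finsetSum _ fun x _ => tendsto_finsetSum _ fun y _ => ?_)
  exact ((hcov x y).2).mul (HD e v w₀ ν₀ s hν₀ hν2 hs0 hs1 hw₀ hv hwb hcoh y x z hz)

/-! ## §3 The limit response is holomorphic and volume-uniformly bounded -/

/-- ★★ **THE LIMIT RESPONSE IS HOLOMORPHIC IN THE COUPLING, WITH 41's VOLUME-UNIFORM BOUND.**  For odd `L ≥ 3`, `a, m² > 0` there is `w₁ > 0` such that for every
volume exponent, every potential tower with `sup|v_N| ≤ w₀ ≤ w₁`, `w₀ > 0`, coherence defect `≤ ν₀s^k`, every `0 < r < 1` and every margin `0 < ρ₀ < R₂`,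
`R₂ := (r∕(1+r))·min(r_K∕w₀, 1)`, with `eS k := e_{k+1}`:  on the ball `‖z‖ < R₂ − ρ₀`  (i) `vitaliLim eS` is ℂ-differentiable, (ii) `eS → vitaliLim eS` locally
uniformly, (iii) `vitaliLim eS z = |Λ|⁻¹·Σ_{x,y} C^{(∞)}_z(x,y)·∂_zΔ^{(∞)}_{z·v}(y,x)` (§2's limit), (iv) `‖vitaliLim eS z‖ ≤ (2∕γ₀)·(M_Δ∕ρ₀)·K_{d+1}((1−λ(r))·2κ′)` —
uniformly in the volume (28c `vitali_disc` on 41's `differentiableOn_logDetResponseC` ∕ `norm_logDetResponseC_le` and §2).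
[cite: King1986, §4 pp.675–676 (A = 0 template); Balaban1985BackgroundPropagators, Thm 3.4 p.400; Ransford1995, Thm. 4.3.7] -/
theorem logDetResponse_limit_holomorphic (hLodd : Odd L) (hL : 2 ≤ L) {a m2 : ℝ} (ha : 0 < a) (hm : 0 < m2) :
    ∃ w₁ : ℝ, 0 < w₁ ∧
      ∀ (e : ℕ) (v : ∀ N : ℕ, Tor (fine N (kingU d L e)) → ℝ) (w₀ ν₀ s : ℝ),
      0 ≤ ν₀ → ν₀ ≤ w₁ → 0 ≤ s → s ≤ (L : ℝ) ^ (-(1 / 2 : ℝ)) →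
      0 < w₀ → (∀ (N : ℕ) (x : Tor (fine N (kingU d L e))), |v N x| ≤ w₀) → w₀ ≤ w₁ →
      (∀ (k : ℕ), 1 ≤ k → ∀ x' : Tor (fine (L ^ 1 * L ^ k) (kingU d L e)),
          |v (L ^ 1 * L ^ k) x' - v (L ^ k) (underPtN L k 1 (kingU d L e) x')| ≤ ν₀ * s ^ k) →
      ∀ (r : ℝ), 0 < r → r < 1 → ∀ (ρ₀ : ℝ), 0 < ρ₀ → ρ₀ < r / (1 + r) * min (cplxWindow d a m2 L / w₀) 1 →
        let eS : ℕ → ℂ → ℂ := fun k z => logDetResponseC d a m2 L (kingM d L e) (k + 1) (v (L ^ (k + 1))) z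
        let R' : ℝ := r / (1 + r) * min (cplxWindow d a m2 L / w₀) 1 - ρ₀
        DifferentiableOn ℂ (vitaliLim eS) (ball 0 R') ∧
        TendstoLocallyUniformlyOn eS (vitaliLim eS) atTop (ball 0 R') ∧
        (∀ z ∈ ball (0 : ℂ) R', vitaliLim eS z
          = ((Fintype.card (Tor (kingU d L e)) : ℂ))⁻¹ *
              ∑ x, ∑ y, kingCovLimC a m2 L (kingM d L e) v z x y * deriv (fun ζ : ℂ => kingLevelLimC a m2 L (kingM d L e) v ζ y x) z) ∧
        (∀ z ∈ ball (0 : ℂ) R', ‖vitaliLim eS z‖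
          ≤ 2 / gam0L (d + 1) a L * (max (a + a ^ 2 * ctCK (d + 1) a L) (a + 2 * a ^ 2 / m2) / ρ₀
              * latticeConst (d + 1) ((1 - lam r) * (2 * kapCT (d + 1) a L)))) := by
  obtain ⟨w₁, hw₁, HT⟩ := tendsto_logDetResponseC (d := d) L hLodd hL ha hm
  have hwb := (dressedConsts_nonneg (d := d) (a := a) (L := L) ha hL).2.2
  refine ⟨min w₁ (wbarK (d + 1) a L), lt_min hw₁ hwb, ?_⟩
  intro e v w₀ ν₀ s hν₀ hν₁ hs0 hs1 hw₀ hv hw₁' hcoh r hr0 hr1 ρ₀ hρ₀ hρR eS R'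
  have hν1 : ν₀ ≤ w₁ := hν₁.trans (min_le_left _ _)
  have hwa : w₀ ≤ w₁ := hw₁'.trans (min_le_left _ _)
  have hwbar : w₀ ≤ wbarK (d + 1) a L := hw₁'.trans (min_le_right _ _)
  have hwin := cplxWindow_pos (d := d) (a := a) (m2 := m2) (L := L) ha hm hL
  obtain ⟨hrad1, hrad2⟩ := disc_radius_le (d := d) (a := a) (m2 := m2) L hr0 hw₀ hwin
  have hR' : 0 < R' := by show 0 < r / (1 + r) * min (cplxWindow d a m2 L / w₀) 1 - ρ₀; linarith
  set B : ℝ := 2 / gam0L (d + 1) a L * (max (a + a ^ 2 * ctCK (d + 1) a L) (a + 2 * a ^ 2 / m2) / ρ₀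
    * latticeConst (d + 1) ((1 - lam r) * (2 * kapCT (d + 1) a L))) with hB
  -- Vitali's hypotheses for eS on ball 0 R'
  have hsubR : ball (0 : ℂ) R' ⊆ ball 0 (min (cplxWindow d a m2 L / w₀) 1) :=
    ball_subset_ball (by show r / (1 + r) * min (cplxWindow d a m2 L / w₀) 1 - ρ₀ ≤ _; linarith)
  have hd : ∀ k, DifferentiableOn ℂ (eS k) (ball 0 R') := fun k =>
    (differentiableOn_logDetResponseC (d := d) (M := kingM d L e) ha hm hL (Nat.succ_le_succ (Nat.zero_le k)) hw₀ (hv _)).mono hsubR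
  have hb : ∀ k, ∀ z ∈ ball (0 : ℂ) R', ‖eS k z‖ ≤ B := by
    intro k z hz
    rw [mem_ball_zero_iff] at hz
    have hzρ : ‖z‖ + ρ₀ < r / (1 + r) * min (cplxWindow d a m2 L / w₀) 1 := by
      show ‖z‖ + ρ₀ < _; have : ‖z‖ < r / (1 + r) * min (cplxWindow d a m2 L / w₀) 1 - ρ₀ := hz; linarith
    exact norm_logDetResponseC_le (M := kingM d L e) ha hm hL (Nat.succ_le_succ (Nat.zero_le k)) hw₀ hwbar hv hr0 hr1 hρ₀ hzρ
  have hballR : ∀ z ∈ ball (0 : ℂ) R', z ∈ ball (0 : ℂ) (cplxWindow d a m2 L / w₀) := fun z hz =>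
    mem_ball_zero_iff.2 (lt_of_lt_of_le (mem_ball_zero_iff.1 (hsubR hz)) (min_le_left _ _))
  have hconv : ∀ t : ℝ, 0 < t → t < R' → ∃ l : ℂ, Tendsto (fun k => eS k (t : ℂ)) atTop (𝓝 l) := by
    intro t ht0 htR
    have ht : ((t : ℂ)) ∈ ball (0 : ℂ) R' := by
      rw [mem_ball_zero_iff, Complex.norm_real, Real.norm_eq_abs, abs_of_pos ht0]; exact htR
    exact ⟨_, HT e v w₀ ν₀ s hν₀ hν1 hs0 hs1 hw₀ hv hwa hcoh (t : ℂ) (hballR _ ht)⟩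
  have hV := vitali_disc hR' hR' hd hb hconv
  refine ⟨hV.1, hV.2.1, fun z hz => ?_, fun z hz => norm_vitaliLim_le hR' hR' hd hb hconv hz⟩
  exact vitaliLim_eq_of_tendsto hR' hR' hd hb hconv hz (HT e v w₀ ν₀ s hν₀ hν1 hs0 hs1 hw₀ hv hwa hcoh z (hballR z hz))

end KingU

end Summit.QuantumFields.YangMills.BalabanUVNodes.N15.KingModel

end
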